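import Summits.ResolutionOfSingularities.ResolutionOfSingularities.Theorems.EquisingularLiftEquisingularLiftNatExactShadowELNat
import Summits.ResolutionOfSingularities.ResolutionOfSingularities.Theorems.EquisingularLiftEquisingularLiftNatPointTail
import Summits.ResolutionOfSingularities.ResolutionOfSingularities.Theorems.EquisingularLiftEquisingularLiftNatMultisectionAdapterDim
import Summits.ResolutionOfSingularities.ResolutionOfSingularities.Theorems.EquisingularLiftEquisingularLiftHorizResolutionBase
import Summits.ResolutionOfSingularities.ResolutionOfSingularities.Theorems.EquisingularLiftEquisingularLiftProjectiveAmbientIntegralFibre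
import HarnessLib

/-!
# [OURS · L1 W4.5(b) · EL♮] RUNG T-ISO-2 «POINT-RESOLVABLE BY BLOW-UPS AT ARBITRARY CLOSED POINTS ⇒ EL♮», hypothesis-free
# (crux `EquisingularLiftNat` = stmt-ResolutionOfSingularities-20038, line `sections`; any `n`)

HONEST FRAMING. OURS (cell res-hironaka, crux chain w45b, slot W4.5(b)); NOT a statement of any manuscript; AI-written, weaker than
expert review. Helper `--supports stmt-ResolutionOfSingularities-20038 --as helper` (res-L1-w45b-stub-2 g4; the T-ISO-2 object is
res-type-022's, res-L1-w45b-lead-2 2026-08-27T08:43:24Z — this is only its item-spelling corollary, left out there).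

THE RUNG. Let `k` be algebraically closed of characteristic `p`, `H ⊆ ℙⁿ_k` an integral closed subscheme, and suppose `H` reaches
a regular scheme by finitely many blow-ups at closed NON-REGULAR points `z` whose maximal ideal needs at most `n` generators
(`μ(𝔪_{Γ,z}) ≤ n` — automatic for points of schemes embedded in a regular `n`-fold; the inductive closure of T-TAIL, verbatim). Then
`ELNatAt p k n H ι`: over the Witt ring `O = W(k)` the reduced special fibre `H` of `ℙⁿ_O` is made regular, with irreducible special
fibre of the ambient, by a chain of blow-ups in regular `O`-flat centres meeting the special fibre inside the running strict transform
(the item's E1 clause). Compared with T-ISO-0 (`target_elnat_of_pointResolution`, p505885: the centres are SECTIONS through the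
blown-up points, which needs the ambient to be `O`-smooth there) the centres are res-D-pv-003's ramified MULTISECTIONS
(`exists_multisection`, p510326), which exist at EVERY closed point of every stage (the stages are regular but not `O`-smooth after
the first multisection step); their existence needs only `dim 𝒪_{X′,b} = n + 1` (T-DIM, p513633) and the embedding-dimension drop.

ASSEMBLY (nothing new is proved here): T-TAIL `horizChainE1_of_pointResolvable` (res-D-pv-013, p508794) at the initial stage
`(ℙⁿ_O, 𝟙, Y)` + the (MS) device `hMS_of_multisection_of_smoothOfRelativeDimension` (res-D-pv-003's adapter p513364 ∘ T-DIM,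
p514806) + `natChain_and_isIrreducible_of_horizChainE1` (res-L1-w45b-lead-2, p500485); the fixed-ambient set-up is copied from
res-D-pv-037's `elNatOver_of_exactShadow` (p510833). The general-base forms of the rung (from ANY horizontal-E1 stage, both `Adm`
spellings) are res-type-022's `horizChainE1_of_surfacePointResolvable[_finrank]` (p516560 / p517448) and res-D-pv-003's
`horizChainE1_of_pointResolvableInv_multisection` (p515683); this file only adds the ITEM'S `ℙⁿ_O` SPELLING (`ELNatOver` / `ELNatAt`),
which those files leave out (its statement needs no graded-ring instance: `ELNatOver` carries it internally).

* `elNatOver_of_pointResolvable_embDim` — over a given complete DVR `(O, π)` of characteristic `0` with `π : O → k` onto;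
* `elNatAt_of_pointResolvable_embDim` — `ELNatAt p k n H ι`, with `O = W(k)` (`stub_wittRing`).

References: the cited tree files; Liu, *Algebraic Geometry and Arithmetic Curves* (2002) §8.1 (blow-ups), Matsumura Thms. 8.4, 14.2,
15.6 (through the tree files).
-/

set_option linter.dupNamespace false -- mandated namespace `Summit.<Summit>.<Problem>` of this single-conjunct summit

noncomputable section

open CategoryTheory CategoryTheory.Limits AlgebraicGeometry TopologicalSpace Topology
open MvPolynomial HomogeneousIdeal
open Literature.AlgebraicGeometry.Resolution
open AlgebraicGeometry.Scheme.IdealSheafData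
open Summit.ResolutionOfSingularities.ResolutionOfSingularities.Theses.EquisingularLift.Split
open Summit.ResolutionOfSingularities.ResolutionOfSingularities.Cruxes.EquisingularLift.StrataSplit

namespace Summit.ResolutionOfSingularities.ResolutionOfSingularities.Cruxes.EquisingularLiftNat.Sections

/-- The residue field of a local ring `O` mapping onto a field `k` is algebraically closed if `k` is (the kernel of `π` is the
maximal ideal, so `O/𝔪 ≅ k`). [folklore] -/
theorem isAlgClosed_residueField_of_surjective {O : Type} [CommRing O] [IsLocalRing O] {k : Type} [Field k] [IsAlgClosed k]
    (π : O →+* k) (hπ : Function.Surjective π) : IsAlgClosed (IsLocalRing.ResidueField O) := by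
  have hker : RingHom.ker π = IsLocalRing.maximalIdeal O :=
    IsLocalRing.eq_maximalIdeal (RingHom.ker_isMaximal_of_surjective π hπ)
  let e : IsLocalRing.ResidueField O ≃+* k :=
    (Ideal.quotEquivOfEq hker.symm).trans (RingHom.quotientKerEquivOfSurjective hπ)
  exact IsAlgClosed.of_ringEquiv k _ e.symm

/-- **RUNG T-ISO-2 over a given lift ring.** `k` algebraically closed of characteristic `p`, `H ⊆ ℙⁿ_k` integral closed,
`O` a complete DVR of characteristic `0` with `π : O → k` onto. If `H` reaches a regular scheme by blow-ups at closed non-regular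
points `z` with `μ(𝔪_{Γ,z}) ≤ n` (T-TAIL's inductive closure), then `ELNatOver p k n H ι O π`. Assembly of T-TAIL (p508794), the
multisection adapter with T-DIM (p514806) and the horizontal-chain glue (p500485). [folklore; Liu 2002 §8.1] -/
theorem elNatOver_of_pointResolvable_embDim {p : ℕ} (k : Type) [Field k] [CharP k p] [IsAlgClosed k] (n : ℕ) (H : Scheme.{0})
    (ι : H ⟶ (Literature.AlgebraicGeometry.Motives.projectiveSpace n k).left) [IsClosedImmersion ι] [IsIntegral H]
    (O : Type) [CommRing O] [IsDomain O] [IsDiscreteValuationRing O] [CharZero O]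
    [IsAdicComplete (IsLocalRing.maximalIdeal O) O] (π : O →+* k) (hπ : Function.Surjective π)
    (hres : ∃ Γs : Scheme.{0}, (∀ R : Scheme.{0} → Prop, R H →
      (∀ (Γ₁ Γ₂ : Scheme.{0}) (x : Γ₁) (hx : IsClosed ({x} : Set Γ₁)) (υ : Γ₂ ⟶ Γ₁), R Γ₁ →
        ¬ IsRegularLocalRing (Γ₁.presheaf.stalk x) →
        (IsLocalRing.maximalIdeal (Γ₁.presheaf.stalk x)).spanFinrank ≤ n →
        IsBlowup υ (vanishingIdeal ⟨{x}, hx⟩) → R Γ₂) → R Γs) ∧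
      Scheme.IsRegular Γs) :
    Theorems.EquisingularLift.ELNatOver p k n H ι O π := by
  classical
  letI := MvPolynomial.gradedAlgebra (σ := Fin (n + 1)) (R := O)
  letI := MvPolynomial.gradedAlgebra (σ := Fin (n + 1)) (R := k)
  intro φ hφ' hφ Y hYdef
  subst hYdef
  haveI : IsAlgClosed (IsLocalRing.ResidueField O) := isAlgClosed_residueField_of_surjective π hπ
  -- the fixed ambient `P = ℙⁿ_O`, its structure morphism `q`, and the closed immersion `g : ℙⁿ_k ⟶ ℙⁿ_O` onto the special fibre
  set q : Proj (homogeneousSubmodule (Fin (n + 1)) O) ⟶ Spec (.of O) :=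
    Proj.toSpecZero (homogeneousSubmodule (Fin (n + 1)) O) ≫
      Spec.map (CommRingCat.ofHom (algebraMap O (homogeneousSubmodule (Fin (n + 1)) O 0))) with hq
  have hP := ProjectiveAmbientFibre.isPullback_projMap π φ hφ hπ hφ'
  set g : Proj (homogeneousSubmodule (Fin (n + 1)) k) ⟶ Proj (homogeneousSubmodule (Fin (n + 1)) O) :=
    Proj.map φ hφ' with hg
  haveI : IsClosedImmersion (Spec.map (CommRingCat.ofHom π)) := IsClosedImmersion.spec_of_surjective _ hπ
  haveI : IsClosedImmersion g := MorphismProperty.IsStableUnderBaseChange.of_isPullback hP.flip inferInstance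
  have hpt : ∀ x : Spec (.of k), Spec.map (CommRingCat.ofHom π) x = IsLocalRing.closedPoint O := by
    intro x
    rw [Spec.map_apply]
    apply PrimeSpectrum.ext
    rw [PrimeSpectrum.comap_asIdeal, CommRingCat.hom_ofHom, Ideal.eq_bot_of_prime x.asIdeal, ← RingHom.ker_eq_comap_bot]
    exact IsLocalRing.eq_maximalIdeal (RingHom.ker_isMaximal_of_surjective π hπ)
  have hgq : ∀ x, q (g x) = IsLocalRing.closedPoint O := fun x ↦
    (Scheme.Hom.comp_apply g q x).symm.trans
      ((congrArg (fun h : Proj (homogeneousSubmodule (Fin (n + 1)) k) ⟶ Spec (.of O) ↦ h x) hP.w).trans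
        ((Scheme.Hom.comp_apply _ _ x).trans (hpt _)))
  -- the closed immersion `f = ι ≫ g : H ⟶ ℙⁿ_O` and its (closed) range `Y`
  let ι' : H ⟶ Proj (homogeneousSubmodule (Fin (n + 1)) k) := ι
  haveI : IsClosedImmersion ι' := ‹IsClosedImmersion ι›
  let f : H ⟶ Proj (homogeneousSubmodule (Fin (n + 1)) O) := ι' ≫ g
  let Yc : Closeds (Proj (homogeneousSubmodule (Fin (n + 1)) O)) := ⟨Set.range f, f.isClosedEmbedding.isClosed_range⟩
  have hYc : (Yc : Set (Proj (homogeneousSubmodule (Fin (n + 1)) O))) = Set.range (ι ≫ Proj.map φ hφ') := rfl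
  have hsub : (Yc : Set (Proj (homogeneousSubmodule (Fin (n + 1)) O))) ⊆ q ⁻¹' {IsLocalRing.closedPoint O} := by
    rintro _ ⟨x, rfl⟩
    show q (f x) = IsLocalRing.closedPoint O
    rw [show f x = g (ι' x) from Scheme.Hom.comp_apply _ _ x]
    exact hgq (ι' x)
  obtain ⟨hsm, hprop⟩ := stub_projectiveAmbientSmoothProper O n
  have hint := isIntegral_specialFibre_projectiveSpace O n
  haveI : IsIntegral (Proj (homogeneousSubmodule (Fin (n + 1)) O)) :=
    Proj.isIntegral _ (irrelevant_homogeneousSubmodule_ne_bot n O)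
  haveI : SmoothOfRelativeDimension n q := smoothOfRelativeDimension_toSpecZero_specMap n O
  -- `H` is reduced: `V(Y)_red ≅ H`
  obtain ⟨e⟩ := nonempty_iso_subscheme_vanishingIdeal_range f
  -- `Y` is irreducible
  have hgen : IsGenericPoint (f (genericPoint H)) (Yc : Set (Proj (homogeneousSubmodule (Fin (n + 1)) O))) := by
    have h := (genericPoint_spec H).image f.continuous
    rwa [Set.image_univ, f.isClosedEmbedding.isClosed_range.closure_eq] at h
  have hYirr : IsIrreducible (Yc : Set (Proj (homogeneousSubmodule (Fin (n + 1)) O))) := by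
    have h := (isIrreducible_singleton (x := f (genericPoint H))).closure
    rwa [hgen] at h
  -- EL♮'s HORIZONTAL induction principle as a stage predicate over the fixed base
  obtain ⟨Ch, hCh⟩ : ∃ Ch : ∀ X' : Scheme.{0}, (X' ⟶ Proj (homogeneousSubmodule (Fin (n + 1)) O)) → Set X' → Prop,
      ∀ (X₁ : Scheme.{0}) (σ₁ : X₁ ⟶ Proj (homogeneousSubmodule (Fin (n + 1)) O)) (S₁ : Set X₁), Ch X₁ σ₁ S₁ ↔
      ∀ Q : (∀ X' : Scheme.{0}, (X' ⟶ Proj (homogeneousSubmodule (Fin (n + 1)) O)) → Set X' → Prop),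
        Q (Proj (homogeneousSubmodule (Fin (n + 1)) O)) (𝟙 _) (Yc : Set (Proj (homogeneousSubmodule (Fin (n + 1)) O))) →
        (∀ (X' X'' : Scheme.{0}) (σ' : X' ⟶ Proj (homogeneousSubmodule (Fin (n + 1)) O)) (Y' : Set X')
          (C : X'.IdealSheafData) (τ : X'' ⟶ X'), Q X' σ' Y' → IsBlowup τ C → Scheme.IsRegular C.subscheme →
          Flat (C.subschemeι ≫ σ' ≫ q) →
          σ' '' (C.support : Set X') ⊆ {x | ¬ IsGenericPoint x (Yc : Set (Proj (homogeneousSubmodule (Fin (n + 1)) O)))} →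
          (C.support : Set X') ∩ (σ' ≫ q) ⁻¹' {IsLocalRing.closedPoint O} ⊆ Y' →
          Q X'' (τ ≫ σ') (closure (τ ⁻¹' (Y' \ (C.support : Set X'))))) →
        Q X₁ σ₁ S₁ := ⟨_, fun _ _ _ => Iff.rfl⟩
  have hChain : ∀ (X' : Scheme.{0}) (σ : X' ⟶ Proj (homogeneousSubmodule (Fin (n + 1)) O)) (S : Set X'),
      Ch X' σ S → Chain (Proj (homogeneousSubmodule (Fin (n + 1)) O))
        (Yc : Set (Proj (homogeneousSubmodule (Fin (n + 1)) O))) X' σ S :=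
    fun X' σ S h Q h0 hs => (hCh X' σ S).mp h Q h0
      (fun X₁ X₂ σ' Y' C τ hQ hb hr _ hg' _ => hs X₁ X₂ σ' Y' C τ hQ hb hr hg')
  have hStep : ∀ (X' X'' : Scheme.{0}) (σ' : X' ⟶ Proj (homogeneousSubmodule (Fin (n + 1)) O)) (S' : Set X')
      (C : X'.IdealSheafData) (τ : X'' ⟶ X'),
      Ch X' σ' S' → IsBlowup τ C → Scheme.IsRegular C.subscheme → Flat (C.subschemeι ≫ σ' ≫ q) →
      σ' '' (C.support : Set X') ⊆ {x | ¬ IsGenericPoint x (Yc : Set (Proj (homogeneousSubmodule (Fin (n + 1)) O)))} →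
      (C.support : Set X') ∩ (σ' ≫ q) ⁻¹' {IsLocalRing.closedPoint O} ⊆ S' →
      Ch X'' (τ ≫ σ') (closure (τ ⁻¹' (S' \ (C.support : Set X')))) :=
    fun X' X'' σ' S' C τ h hb hr hfl hg' hE => (hCh _ _ _).mpr fun Q h0 hs =>
      hs X' X'' σ' S' C τ ((hCh X' σ' S').mp h Q h0 hs) hb hr hfl hg' hE
  have hCh₀ : Ch (Proj (homogeneousSubmodule (Fin (n + 1)) O)) (𝟙 _)
      (Yc : Set (Proj (homogeneousSubmodule (Fin (n + 1)) O))) := (hCh _ _ _).mpr fun Q h0 _ => h0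
  -- the base isomorphism `H ≅ V(closure Y)_red`
  have hZ2 : (⟨closure (Yc : Set (Proj (homogeneousSubmodule (Fin (n + 1)) O))), isClosed_closure⟩ :
      Closeds (Proj (homogeneousSubmodule (Fin (n + 1)) O))) = Yc := Closeds.ext Yc.isClosed.closure_eq
  have e₀ : H ≅ (vanishingIdeal (⟨closure (Yc : Set (Proj (homogeneousSubmodule (Fin (n + 1)) O))), isClosed_closure⟩ :
      Closeds (Proj (homogeneousSubmodule (Fin (n + 1)) O)))).subscheme := by
    rw [hZ2]
    exact e.symm
  -- the (MS) device: multisections (adapter ∘ T-DIM), admissibility = embedding dimension ≤ n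
  have hMS := hMS_of_multisection_of_smoothOfRelativeDimension O (Proj (homogeneousSubmodule (Fin (n + 1)) O)) q Yc Ch
    hChain hsub hYirr n
  -- the engine: T-TAIL at the initial stage
  obtain ⟨X₁, σ₁, S₁, hCh₁, hreg₁⟩ := horizChainE1_of_pointResolvable O (Proj (homogeneousSubmodule (Fin (n + 1)) O)) q Yc
    Ch hChain hStep hsm hprop hsub hYirr
    (fun Γ x => (IsLocalRing.maximalIdeal (Γ.presheaf.stalk x)).spanFinrank ≤ n)
    (spanFinrank_maximalIdeal_stalk_le_of_iso n) hMS _ (𝟙 _) _ hCh₀ H e₀ hres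
  -- the item's E1 clause and the irreducible special fibre (p500485)
  obtain ⟨hch, hirr⟩ := natChain_and_isIrreducible_of_horizChainE1 O _ X₁ q
    (Yc : Set (Proj (homogeneousSubmodule (Fin (n + 1)) O))) σ₁ S₁ hsm hprop hint hYirr Yc.isClosed hsub
    ((hCh X₁ σ₁ S₁).mp hCh₁)
  exact ⟨X₁, σ₁, S₁, hch, hirr, hreg₁⟩

/-- **RUNG T-ISO-2 «POINT-RESOLVABLE AT ARBITRARY CLOSED POINTS ⇒ EL♮»** (`p` prime, `k` algebraically closed of characteristic
`p`, `H ⊆ ℙⁿ_k` integral closed): if `H` reaches a regular scheme by blow-ups at closed non-regular points `z` with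
`μ(𝔪_{Γ,z}) ≤ n`, then `ELNatAt p k n H ι` (lift ring = the Witt vectors `W(k)`, `stub_wittRing`). [folklore; Liu 2002 §8.1] -/
theorem elNatAt_of_pointResolvable_embDim {p : ℕ} (hp : p.Prime) (k : Type) [Field k] [CharP k p] [IsAlgClosed k] (n : ℕ)
    (H : Scheme.{0}) (ι : H ⟶ (Literature.AlgebraicGeometry.Motives.projectiveSpace n k).left) [IsClosedImmersion ι]
    [IsIntegral H]
    (hres : ∃ Γs : Scheme.{0}, (∀ R : Scheme.{0} → Prop, R H →
      (∀ (Γ₁ Γ₂ : Scheme.{0}) (x : Γ₁) (hx : IsClosed ({x} : Set Γ₁)) (υ : Γ₂ ⟶ Γ₁), R Γ₁ →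
        ¬ IsRegularLocalRing (Γ₁.presheaf.stalk x) →
        (IsLocalRing.maximalIdeal (Γ₁.presheaf.stalk x)).spanFinrank ≤ n →
        IsBlowup υ (vanishingIdeal ⟨{x}, hx⟩) → R Γ₂) → R Γs) ∧
      Scheme.IsRegular Γs) :
    Theorems.EquisingularLift.ELNatAt p k n H ι := by
  obtain ⟨O, i1, i2, i3, i4, i5, i6, π, hπ⟩ := stub_wittRing p hp k
  exact Theorems.EquisingularLift.elNatAt_of_elNatOver hπ
    (elNatOver_of_pointResolvable_embDim k n H ι O π hπ hres)

end Summit.ResolutionOfSingularities.ResolutionOfSingularities.Cruxes.EquisingularLiftNat.Sections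

end
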